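import Literature.Barriers.Schanuel.NesterenkoModularScopeSiegel
import Literature.Barriers.Schanuel.NesterenkoModularScopeAnalytic
import Mathlib.Analysis.SpecialFunctions.Pow.Real
import Mathlib.Analysis.SpecialFunctions.Sqrt
import HarnessLib

/-!
# Barrier (Schanuel) `NesterenkoModularScope`: Lemma 3.2 of LNM 1752 Ch. 3 (`|F(z)| ≤ |z|^M M^{48N}` on `|z| ≤ r`) — proofs only

`Literature/Barriers/Schanuel/NesterenkoModularScopeSupBound.lean` — proofs only (no new
definitions). Third step of the ANALYTIC half of LNM 1752 Ch. 3 Lemma 3.4: the printed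

  LEMMA 3.2. If the number `N` is sufficiently large, then for all `z ∈ ℂ`, `|z| ≤ r`, the following
  estimate holds: `|F(z)| ≤ |z|^M M^{48N}`

(`F(z) = A(z, P(z), Q(z), R(z))`, `M = ord F`, (9) `M ≥ ½N⁴`), in the uniform form used by the
vendored Lemma 3.4 (`NesterenkoPhilippon2001_ch3_lemma_3_4`): for every `0 < r < 1` there is `N₀(r)`
such that the estimate holds for all `N ≥ N₀`, all `A ∈ ℤ[z, x̄]` with `deg_z A, deg_{xᵢ} A ≤ N`,
`log H(A) ≤ 85 N log N`, and all `M` with `ord_{z=0} A(z, P, Q, R) = M ≥ N⁴/2`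
(`norm_aeval_le_of_order`). Ingredients:

* `abs_coeff_ramanujanComposite_le`: `|bₙ| ≤ (N+1)⁴ H(A) 504^{3N} (n+1)^{21N+2}` (the majorants (7)
  of `NesterenkoModularScopeSiegel.lean`, summed over the `≤ (N+1)⁴` monomials of `A`);
* `tsum_succ_pow_mul_geometric_le`: `∑ₙ (n+1)^p rⁿ ≤ s⁻¹(1−s)⁻¹ e^{−p} (p / log(1/s))^p`, `s = √r`
  (from `log y ≤ y − 1`), whose logarithm is `p log p + O_r(p)`;
* `supBound_bookkeeping`: with `p = 21N + 2`, `log H ≤ 85 N log N`, `4 log N ≤ log 2 + log M` the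
  exponents add up to `85/4 + 21 + 21/4 = 47.5 < 48` (the printed count is `103/4 + 17 + 17/4`).

## References

* [NesterenkoPhilippon2001] LNM 1752 (2001), Ch. 3 §3 Lemma 3.2 and its proof, (7)–(9) (p. 35).
-/

noncomputable section

open Complex MvPolynomial Filter Topology Finset
open Literature.NumberTheory.Transcendental

namespace Literature.Barriers.Schanuel

/-! ### `|bₙ| ≤ (N+1)⁴ H(A) 504^{3N} (n+1)^{21N+2}` -/

/-- A polynomial with partial degrees `≤ N` in four variables has at most `(N+1)⁴` monomials.
[folklore] -/
theorem card_support_le_of_degreeOf_le {N : ℕ} (A : MvPolynomial (Fin 4) ℤ)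
    (hA : ∀ i, A.degreeOf i ≤ N) : A.support.card ≤ (N + 1) ^ 4 := by
  classical
  have hmem : ∀ m ∈ A.support, ∀ i, m i ≤ N := fun m hm i =>
    ((degreeOf_le_iff.mp (le_refl (A.degreeOf i))) m hm).trans (hA i)
  let f : (Fin 4 →₀ ℕ) → (Fin 4 → Fin (N + 1)) := fun m i => ⟨min (m i) N, by omega⟩
  have hcard : (Finset.univ : Finset (Fin 4 → Fin (N + 1))).card = (N + 1) ^ 4 := by simp
  rw [← hcard]
  refine Finset.card_le_card_of_injOn f (fun m _ => Finset.mem_coe.mpr (Finset.mem_univ _)) ?_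
  intro m hm m' hm' h
  ext i
  have h1 := hmem m hm i
  have h2 := hmem m' hm' i
  have := congrArg (fun g : Fin 4 → Fin (N + 1) => (g i : ℕ)) h
  simp only [f] at this
  omega

/-- **The Taylor coefficients of `F = A(z, P, Q, R)`**: for `A ∈ ℤ[z, x̄]` with partial degrees `≤ N`,
`|bₙ| ≤ (N+1)⁴ H(A) 504^{3N} (n+1)^{21N+2}`. [cite: NesterenkoPhilippon2001, Ch. 3 §3 (7) and proof of Lemma 3.2 (p. 35)] -/
theorem abs_coeff_ramanujanComposite_le {N : ℕ} (A : MvPolynomial (Fin 4) ℤ)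
    (hA : ∀ i, A.degreeOf i ≤ N) (n : ℕ) :
    |PowerSeries.coeff n (ramanujanComposite A)| ≤
      (N + 1) ^ 4 * (mvPolyHeight A : ℤ) * (504 ^ (3 * N) * ((n : ℤ) + 1) ^ (21 * N + 2)) := by
  classical
  have hmem : ∀ m ∈ A.support, ∀ i, m i ≤ N := fun m hm i =>
    ((degreeOf_le_iff.mp (le_refl (A.degreeOf i))) m hm).trans (hA i)
  -- each monomial of `A`
  have hmono : ∀ m ∈ A.support,
      |PowerSeries.coeff n (ramanujanComposite (monomial m (A.coeff m)))| ≤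
        (mvPolyHeight A : ℤ) * (504 ^ (3 * N) * ((n : ℤ) + 1) ^ (21 * N + 2)) := by
    intro m hm
    set k : Fin 4 → Fin (N + 1) := fun i => ⟨m i, Nat.lt_succ_of_le (hmem m hm i)⟩ with hk
    have hmk : (Finsupp.equivFunOnFinite.symm fun i => (k i : ℕ)) = m := by
      ext i; simp [hk]
    have hb := coeffBound_composite_monomial k n
    rw [hmk] at hb
    rw [coeff_ramanujanComposite_monomial, abs_mul]
    refine mul_le_mul ?_ hb (abs_nonneg _) (by positivity)
    have := natAbs_coeff_le_mvPolyHeight A m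
    rw [Int.abs_eq_natAbs]
    exact_mod_cast this
  conv_lhs => rw [A.as_sum, ramanujanComposite_sum, map_sum]
  refine (Finset.abs_sum_le_sum_abs _ _).trans ((Finset.sum_le_sum hmono).trans ?_)
  rw [Finset.sum_const, nsmul_eq_mul]
  have hcard := card_support_le_of_degreeOf_le A hA
  have h0 : (0 : ℤ) ≤ (mvPolyHeight A : ℤ) * (504 ^ (3 * N) * ((n : ℤ) + 1) ^ (21 * N + 2)) := by
    positivity
  calc (A.support.card : ℤ) * ((mvPolyHeight A : ℤ) * (504 ^ (3 * N) * ((n : ℤ) + 1) ^ (21 * N + 2)))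
      ≤ ((N + 1) ^ 4 : ℕ) * ((mvPolyHeight A : ℤ) * (504 ^ (3 * N) * ((n : ℤ) + 1) ^ (21 * N + 2))) :=
        mul_le_mul_of_nonneg_right (by exact_mod_cast hcard) h0
    _ = _ := by push_cast; ring

/-! ### `∑ₙ (n+1)^p rⁿ ≤ s⁻¹ (1−s)⁻¹ e^{−p} (p / log(1/s))^p`, `s = √r` -/

/-- `(n+1)^p ≤ s^{−(n+1)} e^{−p} (p/log(1/s))^p` for `0 < s < 1`, `p ≥ 1` (from `log y ≤ y − 1` at
`y = (n+1) log(1/s)/p`). [folklore] -/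
theorem succ_pow_le_geometric {s : ℝ} (hs0 : 0 < s) (hs1 : s < 1) {p : ℕ} (hp : 1 ≤ p) (n : ℕ) :
    ((n : ℝ) + 1) ^ p ≤
      (1 / s) ^ (n + 1) * Real.exp (-(p : ℝ)) * ((p : ℝ) / Real.log (1 / s)) ^ p := by
  set L : ℝ := Real.log (1 / s) with hL
  have hL0 : 0 < L := Real.log_pos (by rw [lt_div_iff₀ hs0]; linarith)
  have hp0 : (0 : ℝ) < p := by exact_mod_cast hp
  have hn0 : (0 : ℝ) < (n : ℝ) + 1 := by positivity
  set y : ℝ := ((n : ℝ) + 1) * L / p with hy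
  have hy0 : 0 < y := by positivity
  -- `log y ≤ y - 1`
  have hlog := Real.log_le_sub_one_of_pos hy0
  rw [hy, Real.log_div (by positivity) hp0.ne', Real.log_mul hn0.ne' hL0.ne'] at hlog
  -- `p log(n+1) ≤ (n+1) L - p + p log (p / L)`
  have hkey : (p : ℝ) * Real.log ((n : ℝ) + 1) ≤
      ((n : ℝ) + 1) * L - p + p * Real.log (p / L) := by
    rw [Real.log_div hp0.ne' hL0.ne']
    have := mul_le_mul_of_nonneg_left hlog hp0.le
    have e : (p : ℝ) * (((n : ℝ) + 1) * L / p - 1) = ((n : ℝ) + 1) * L - p := by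
      field_simp
    nlinarith [this, e]
  -- exponentiate
  have h1 : ((n : ℝ) + 1) ^ p = Real.exp ((p : ℝ) * Real.log ((n : ℝ) + 1)) := by
    rw [Real.exp_nat_mul, Real.exp_log hn0]
  have h2 : Real.exp (((n : ℝ) + 1) * L) = (1 / s) ^ (n + 1) := by
    rw [show ((n : ℝ) + 1) * L = ((n + 1 : ℕ) : ℝ) * L by push_cast; ring, Real.exp_nat_mul, hL,
      Real.exp_log (by positivity)]
  have h3 : Real.exp ((p : ℝ) * Real.log (p / L)) = ((p : ℝ) / L) ^ p := by
    rw [Real.exp_nat_mul, Real.exp_log (by positivity)]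
  rw [h1, ← h2, ← h3, ← Real.exp_add, ← Real.exp_add]
  exact Real.exp_le_exp.mpr (by linarith)

/-- **`∑ₙ (n+1)^p rⁿ ≤ s⁻¹ (1−s)⁻¹ e^{−p} (p / log(1/s))^p`** with `s = √r`, for `0 < r < 1`, `p ≥ 1`;
the series converges. [folklore] -/
theorem tsum_succ_pow_mul_geometric_le {r : ℝ} (hr0 : 0 < r) (hr1 : r < 1) {p : ℕ} (hp : 1 ≤ p) :
    Summable (fun n : ℕ => ((n : ℝ) + 1) ^ p * r ^ n) ∧
    ∑' n : ℕ, ((n : ℝ) + 1) ^ p * r ^ n ≤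
      (Real.sqrt r)⁻¹ * (1 - Real.sqrt r)⁻¹ * Real.exp (-(p : ℝ)) *
        ((p : ℝ) / Real.log (1 / Real.sqrt r)) ^ p := by
  set s : ℝ := Real.sqrt r with hs
  have hs0 : 0 < s := Real.sqrt_pos.mpr hr0
  have hs1 : s < 1 := by rw [hs, Real.sqrt_lt' one_pos]; simpa using hr1
  have hss : s * s = r := Real.mul_self_sqrt hr0.le
  set K : ℝ := (1 / s) * Real.exp (-(p : ℝ)) * ((p : ℝ) / Real.log (1 / s)) ^ p with hK
  have hK0 : 0 ≤ K := by
    have : 0 < Real.log (1 / s) := Real.log_pos (by rw [lt_div_iff₀ hs0]; linarith)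
    positivity
  -- termwise: `(n+1)^p rⁿ ≤ K sⁿ`
  have hterm : ∀ n : ℕ, ((n : ℝ) + 1) ^ p * r ^ n ≤ K * s ^ n := by
    intro n
    have h := succ_pow_le_geometric hs0 hs1 hp n
    have hr : r ^ n = s ^ n * s ^ n := by rw [← mul_pow, hss]
    rw [hr]
    calc ((n : ℝ) + 1) ^ p * (s ^ n * s ^ n)
        ≤ (1 / s) ^ (n + 1) * Real.exp (-(p : ℝ)) * ((p : ℝ) / Real.log (1 / s)) ^ p * (s ^ n * s ^ n) :=
          mul_le_mul_of_nonneg_right h (by positivity)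
      _ = K * s ^ n := by
          rw [hK, pow_succ, one_div_pow]
          field_simp
  have hgeo : HasSum (fun n : ℕ => K * s ^ n) (K * (1 - s)⁻¹) :=
    (hasSum_geometric_of_lt_one hs0.le hs1).mul_left K
  have hsum : Summable (fun n : ℕ => ((n : ℝ) + 1) ^ p * r ^ n) :=
    Summable.of_nonneg_of_le (fun n => by positivity) hterm hgeo.summable
  refine ⟨hsum, ?_⟩
  calc ∑' n : ℕ, ((n : ℝ) + 1) ^ p * r ^ n ≤ ∑' n : ℕ, K * s ^ n :=
        hsum.tsum_le_tsum hterm hgeo.summable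
    _ = K * (1 - s)⁻¹ := hgeo.tsum_eq
    _ = s⁻¹ * (1 - s)⁻¹ * Real.exp (-(p : ℝ)) * ((p : ℝ) / Real.log (1 / s)) ^ p := by
        rw [hK]; ring

/-! ### Bookkeeping: the exponents add up to `47.5 < 48` -/

/-- `log 23 < 3.5` (`23 < 32 = 2⁵`, `log 2 < 0.7`). [folklore] -/
private theorem log_23_lt : Real.log 23 < 3.5 := by
  have h1 : Real.log (23 : ℝ) ≤ Real.log ((2 : ℝ) ^ 5) := Real.log_le_log (by norm_num) (by norm_num)
  rw [Real.log_pow] at h1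
  push_cast at h1
  linarith [Real.log_two_lt_d9]

/-- `log 504 < 6.3` (`504 < 512 = 2⁹`). [folklore] -/
private theorem log_504_lt : Real.log 504 < 6.3 := by
  have h1 : Real.log (504 : ℝ) ≤ Real.log ((2 : ℝ) ^ 9) := Real.log_le_log (by norm_num) (by norm_num)
  rw [Real.log_pow] at h1
  push_cast at h1
  linarith [Real.log_two_lt_d9]

/-- **Bookkeeping for Lemma 3.2**: with `s = √r`, `L = log(1/s)`, for `N ≥ N₀(r)`, `N⁴ ≤ 2M` and
`log H ≤ 85 N log N`,
`(N+1)⁴ · H · 504^{3N} · (M+1)^{21N+2} · s⁻¹(1−s)⁻¹ e^{−(21N+2)} ((21N+2)/L)^{21N+2} ≤ M^{48N}`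
(in logarithms: `(85/4 + 21 + 21/4) N log M + O_r(N) + O(log M) ≤ 48 N log M`).
[cite: NesterenkoPhilippon2001, Ch. 3 §3 proof of Lemma 3.2 (p. 35)] -/
theorem supBound_bookkeeping {r : ℝ} (hr0 : 0 < r) (hr1 : r < 1) :
    ∃ N₀ : ℕ, ∀ (N M H : ℕ), N₀ ≤ N → N ^ 4 ≤ 2 * M → Real.log H ≤ 85 * N * Real.log N →
      ((N : ℝ) + 1) ^ 4 * H * (504 : ℝ) ^ (3 * N) * ((M : ℝ) + 1) ^ (21 * N + 2) *
        ((Real.sqrt r)⁻¹ * (1 - Real.sqrt r)⁻¹ * Real.exp (-((21 * N + 2 : ℕ) : ℝ)) *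
          (((21 * N + 2 : ℕ) : ℝ) / Real.log (1 / Real.sqrt r)) ^ (21 * N + 2)) ≤
        (M : ℝ) ^ (48 * N) := by
  set s : ℝ := Real.sqrt r with hs
  have hs0 : 0 < s := Real.sqrt_pos.mpr hr0
  have hs1 : s < 1 := by rw [hs, Real.sqrt_lt' one_pos]; simpa using hr1
  set L : ℝ := Real.log (1 / s) with hL
  have hL0 : 0 < L := Real.log_pos (by rw [lt_div_iff₀ hs0]; linarith)
  clear_value s
  -- the `r`-dependent constants
  set c₁ : ℝ := Real.log (s⁻¹ * (1 - s)⁻¹) with hc₁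
  set c₂ : ℝ := |Real.log L| with hc₂
  have hc₁0 : 0 ≤ c₁ := Real.log_nonneg (one_le_mul_of_one_le_of_one_le
    ((one_le_inv₀ hs0).mpr hs1.le) ((one_le_inv₀ (by linarith)).mpr (by linarith)))
  have hc₂0 : 0 ≤ c₂ := abs_nonneg _
  set K : ℝ := (132 + 21 * c₂) + (15 + c₁ + 2 * c₂) + 1 with hK
  refine ⟨max 14 ⌈Real.exp K⌉₊, fun N M H hN hNM hH => ?_⟩
  have hN14 : (14 : ℝ) ≤ N := by exact_mod_cast le_trans (le_max_left _ _) hN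
  have hN1 : (1 : ℝ) ≤ N := by linarith
  have hN0 : (0 : ℝ) < N := by linarith
  have hNexp : Real.exp K ≤ N := (Nat.le_ceil _).trans (by exact_mod_cast le_trans (le_max_right _ _) hN)
  -- `a = log N ≥ K`, `ℓ = log M ≥ 4a - 0.7`
  set a : ℝ := Real.log N with ha
  set ℓ : ℝ := Real.log M with hℓ
  have haK : K ≤ a := by rw [ha, ← Real.log_exp K]; exact Real.log_le_log (Real.exp_pos K) hNexp
  have ha0 : 0 ≤ a := Real.log_nonneg hN1
  have hM1 : (1 : ℝ) ≤ M := by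
    have : 1 ≤ M := by
      have h14 : 14 ^ 4 ≤ N ^ 4 := Nat.pow_le_pow_left (by exact_mod_cast hN14) 4
      omega
    exact_mod_cast this
  have hM0 : (0 : ℝ) < M := by linarith
  have hℓ0 : 0 ≤ ℓ := Real.log_nonneg hM1
  have hℓa : 4 * a - 0.7 ≤ ℓ := by
    have h1 : Real.log ((N : ℝ) ^ 4) ≤ Real.log (2 * M) :=
      Real.log_le_log (by positivity) (by exact_mod_cast hNM)
    rw [Real.log_pow, Real.log_mul two_ne_zero hM0.ne'] at h1
    push_cast at h1
    linarith [Real.log_two_lt_d9]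
  -- the case `H = 0` is trivial
  rcases Nat.eq_zero_or_pos H with hH0 | hHpos
  · subst hH0; simp only [Nat.cast_zero, mul_zero, zero_mul]; positivity
  have hHr : (0 : ℝ) < H := by exact_mod_cast hHpos
  -- elementary bounds on the logarithms
  set p : ℕ := 21 * N + 2 with hp
  have hpr : (p : ℝ) = 21 * N + 2 := by rw [hp]; push_cast; ring
  have hp0 : (0 : ℝ) < p := by rw [hpr]; linarith
  have T1 : Real.log ((N : ℝ) + 1) ≤ a + 1 := by
    have h1 : Real.log ((N : ℝ) + 1) ≤ Real.log (2 * N) := Real.log_le_log (by linarith) (by linarith)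
    rw [Real.log_mul two_ne_zero hN0.ne'] at h1
    linarith [Real.log_two_lt_d9]
  have T4 : Real.log ((M : ℝ) + 1) ≤ ℓ + 1 := by
    have h1 : Real.log ((M : ℝ) + 1) ≤ Real.log (2 * M) := Real.log_le_log (by linarith) (by linarith)
    rw [Real.log_mul two_ne_zero hM0.ne'] at h1
    linarith [Real.log_two_lt_d9]
  have T7 : Real.log (p : ℝ) ≤ 3.5 + a := by
    have h1 : Real.log (p : ℝ) ≤ Real.log (23 * N) := Real.log_le_log hp0 (by rw [hpr]; linarith)
    rw [Real.log_mul (by norm_num) hN0.ne'] at h1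
    linarith [log_23_lt]
  have T8 : -Real.log L ≤ c₂ := by rw [hc₂]; exact neg_le_abs _
  -- compare logarithms
  have hLHSpos : 0 < ((N : ℝ) + 1) ^ 4 * H * (504 : ℝ) ^ (3 * N) * ((M : ℝ) + 1) ^ p *
      (s⁻¹ * (1 - s)⁻¹ * Real.exp (-(p : ℝ)) * ((p : ℝ) / L) ^ p) := by positivity
  rw [← Real.log_le_log_iff hLHSpos (by positivity), Real.log_pow,
    Real.log_mul (by positivity) (by positivity), Real.log_mul (by positivity) (by positivity),
    Real.log_mul (by positivity) (by positivity), Real.log_mul (by positivity) (by positivity),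
    Real.log_pow, Real.log_pow, Real.log_pow,
    Real.log_mul (by positivity) (by positivity), Real.log_mul (by positivity) (by positivity),
    ← hc₁, Real.log_exp, Real.log_pow, Real.log_div hp0.ne' hL0.ne']
  -- products bounded one by one, then linear arithmetic
  have P2 : 3 * (N : ℝ) * Real.log 504 ≤ 18.9 * N := by
    have := mul_le_mul_of_nonneg_left log_504_lt.le (by positivity : (0 : ℝ) ≤ 3 * N)
    linarith
  have P4 : (p : ℝ) * Real.log ((M : ℝ) + 1) ≤ (21 * N + 2) * (ℓ + 1) := by
    rw [hpr]; exact mul_le_mul_of_nonneg_left T4 (by linarith)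
  have P7 : (p : ℝ) * (Real.log p - Real.log L) ≤ (21 * N + 2) * (3.5 + a + c₂) := by
    rw [hpr] at *; exact mul_le_mul_of_nonneg_left (by linarith) (by linarith)
  have PH : Real.log H ≤ 85 * N * a := hH
  have Pa : (106 * N + 6) * a ≤ (106 * N + 6) * ((ℓ + 0.7) / 4) :=
    mul_le_mul_of_nonneg_left (by linarith) (by linarith)
  have Pℓ : 14 * ℓ ≤ N * ℓ := mul_le_mul_of_nonneg_right hN14 hℓ0
  have PK : N * (4 * K - 0.7) ≤ N * ℓ := mul_le_mul_of_nonneg_left (by linarith) hN0.le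
  have hc₂N : 0 ≤ (N : ℝ) * c₂ := by positivity
  have hc₁N : 0 ≤ (N : ℝ) * c₁ := by positivity
  rw [hK] at PK
  push_cast
  linarith [T1, P2, P4, P7, PH, Pa, Pℓ, PK, hc₂N, hc₁N, ha0, hℓ0, hc₁0, hc₂0, hN1, hpr]

/-! ### Lemma 3.2 -/

/-- **LNM 1752 Ch. 3 Lemma 3.2, uniform form** (PROVED): for `0 < r < 1` there is `N₀ = N₀(r)` such
that for all `N ≥ N₀`, all `A ∈ ℤ[z, x₁, x₂, x₃]` with `deg_z A, deg_{xᵢ} A ≤ N` and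
`log H(A) ≤ 85 N log N`, and all `M` with `ord_{z=0} A(z, P, Q, R) = M ≥ N⁴/2`, the function
`F(z) = A(z, P(z), Q(z), R(z))` satisfies `|F(z)| ≤ |z|^M M^{48N}` for `|z| ≤ r`.
[cite: NesterenkoPhilippon2001, Ch. 3 Lemma 3.2 (p. 35)] -/
theorem norm_aeval_le_of_order {r : ℝ} (hr0 : 0 < r) (hr1 : r < 1) :
    ∃ N₀ : ℕ, ∀ N : ℕ, N₀ ≤ N → ∀ (A : MvPolynomial (Fin 4) ℤ) (M : ℕ),
      (∀ i, A.degreeOf i ≤ N) → Real.log (mvPolyHeight A : ℝ) ≤ 85 * N * Real.log N →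
      (ramanujanComposite A).order = M → (N : ℝ) ^ 4 / 2 ≤ M →
      ∀ z : ℂ, ‖z‖ ≤ r →
        ‖(MvPolynomial.aeval (ramanujanPoint z) A : ℂ)‖ ≤ ‖z‖ ^ M * (M : ℝ) ^ (48 * N) := by
  obtain ⟨N₀, hN₀⟩ := supBound_bookkeeping hr0 hr1
  refine ⟨N₀, fun N hN A M hdeg hH hord hM z hz => ?_⟩
  have hz1 : ‖z‖ < 1 := hz.trans_lt hr1
  set p : ℕ := 21 * N + 2 with hp
  have hp1 : 1 ≤ p := by omega
  -- the Taylor series and its first `M` vanishing coefficients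
  set b : ℕ → ℂ := fun n => ((PowerSeries.coeff n (ramanujanComposite A) : ℤ) : ℂ) with hb
  have hF := (hasSum_ramanujanComposite_int A hz1).2
  have hb0 : ∀ n, n < M → b n = 0 := by
    intro n hn
    have : PowerSeries.coeff n (ramanujanComposite A) = 0 :=
      PowerSeries.coeff_of_lt_order n (by rw [hord]; exact_mod_cast hn)
    simp [hb, this]
  have hF' : HasSum (fun m => b (m + M) * z ^ (m + M)) (MvPolynomial.aeval (ramanujanPoint z) A) := by
    refine (hasSum_nat_add_iff (f := fun n => b n * z ^ n) M).mpr ?_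
    have : ∑ i ∈ Finset.range M, b i * z ^ i = 0 :=
      Finset.sum_eq_zero fun i hi => by rw [hb0 i (Finset.mem_range.mp hi), zero_mul]
    rw [this, add_zero]
    exact hF
  -- the coefficient bound `‖bₙ‖ ≤ C_b (n+1)^p`
  set Cb : ℝ := ((N : ℝ) + 1) ^ 4 * (mvPolyHeight A : ℝ) * (504 : ℝ) ^ (3 * N) with hCb
  have hCb0 : 0 ≤ Cb := by positivity
  have hbn : ∀ n, ‖b n‖ ≤ Cb * ((n : ℝ) + 1) ^ p := by
    intro n
    have h := abs_coeff_ramanujanComposite_le A hdeg n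
    have h' : |((PowerSeries.coeff n (ramanujanComposite A) : ℤ) : ℝ)| ≤
        ((N : ℝ) + 1) ^ 4 * (mvPolyHeight A : ℝ) * ((504 : ℝ) ^ (3 * N) * ((n : ℝ) + 1) ^ (21 * N + 2)) := by
      rw [← Int.cast_abs]; exact_mod_cast h
    rw [hb, Complex.norm_intCast, hCb, hp]
    linarith
  -- the majorant `g m = ‖z‖^M · C_b (M+1)^p · (m+1)^p r^m`
  obtain ⟨hS, hSle⟩ := tsum_succ_pow_mul_geometric_le hr0 hr1 hp1
  set S : ℝ := ∑' n : ℕ, ((n : ℝ) + 1) ^ p * r ^ n with hSdef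
  have hg : HasSum (fun m : ℕ => ‖z‖ ^ M * (Cb * ((M : ℝ) + 1) ^ p) * (((m : ℝ) + 1) ^ p * r ^ m))
      (‖z‖ ^ M * (Cb * ((M : ℝ) + 1) ^ p) * S) := hS.hasSum.mul_left _
  have hle : ∀ m : ℕ, ‖b (m + M) * z ^ (m + M)‖ ≤
      ‖z‖ ^ M * (Cb * ((M : ℝ) + 1) ^ p) * (((m : ℝ) + 1) ^ p * r ^ m) := by
    intro m
    rw [norm_mul, norm_pow, pow_add]
    have h1 := hbn (m + M)
    have h2 : (((m + M : ℕ) : ℝ) + 1) ^ p ≤ (((M : ℝ) + 1) * ((m : ℝ) + 1)) ^ p := by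
      apply pow_le_pow_left₀ (by positivity)
      push_cast
      nlinarith [(Nat.cast_nonneg m : (0 : ℝ) ≤ m), (Nat.cast_nonneg M : (0 : ℝ) ≤ M)]
    have h3 : ‖z‖ ^ m ≤ r ^ m := pow_le_pow_left₀ (norm_nonneg z) hz m
    have hzM : 0 ≤ ‖z‖ ^ M := by positivity
    calc ‖b (m + M)‖ * (‖z‖ ^ m * ‖z‖ ^ M)
        ≤ (Cb * ((((M : ℝ) + 1) * ((m : ℝ) + 1)) ^ p)) * (r ^ m * ‖z‖ ^ M) :=
          mul_le_mul (h1.trans (mul_le_mul_of_nonneg_left h2 hCb0))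
            (mul_le_mul_of_nonneg_right h3 hzM) (by positivity) (by positivity)
      _ = ‖z‖ ^ M * (Cb * ((M : ℝ) + 1) ^ p) * (((m : ℝ) + 1) ^ p * r ^ m) := by rw [mul_pow]; ring
  have hbound := HasSum.norm_le_of_bounded hF' hg hle
  -- bookkeeping
  have hNM : N ^ 4 ≤ 2 * M := by
    have : ((N ^ 4 : ℕ) : ℝ) ≤ ((2 * M : ℕ) : ℝ) := by push_cast; linarith
    exact_mod_cast this
  have hK := hN₀ N M (mvPolyHeight A) hN hNM hH
  have hfin : Cb * ((M : ℝ) + 1) ^ p * S ≤ (M : ℝ) ^ (48 * N) := by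
    refine le_trans (mul_le_mul_of_nonneg_left hSle (by positivity)) ?_
    simpa only [hCb, hp, mul_assoc] using hK
  calc ‖(MvPolynomial.aeval (ramanujanPoint z) A : ℂ)‖
      ≤ ‖z‖ ^ M * (Cb * ((M : ℝ) + 1) ^ p) * S := hbound
    _ = ‖z‖ ^ M * (Cb * ((M : ℝ) + 1) ^ p * S) := by ring
    _ ≤ ‖z‖ ^ M * (M : ℝ) ^ (48 * N) := mul_le_mul_of_nonneg_left hfin (by positivity)

end Literature.Barriers.Schanuel

end
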